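import Literature.MathematicalPhysics.QuantumFieldTheory.Balaban1983to89.B4Green244

/-!
# `Balaban1983to89.B4Eq243Transform` — [Balaban1983RegularityDecay] p. 584 (2.43): the Fourier transform pair on `ξℤ^d` for
# finitely supported lattice functions, WITH BODIES, and its INVERSION as a kernel theorem

statement-level skeleton of published theorems with citation tags; proofs where landed; nothing here is a claim about the Yang–Mills mass gap

CITATION HEADER.  T. Bałaban, *Regularity and decay of lattice Green's functions*, Commun. Math. Phys. **89** (1983) 571–597,
doi:10.1007/bf01214744 [Balaban1983RegularityDecay] (cell paper B4; journal page = PDF page + 570), p. 584 [PDF 14]; render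
`pub-balaban/b2b-balaban-ref1/pages/1983-cmp89-regularity-decay/1983-cmp89-regularity-decay-p014-x2.png` read as an image by this
seat (unit `lit-balaban-r01` gen 42, B4 fold owner; SKELETON row **B4.Eq2.43**; this file is member 1 of the three owed members named
in `lit-balaban-r01/AUDIT-B4-DEF-g42.md` §Plan; member 2 = `B4Eq246Fibre`).

WHAT IS PRINTED (p. 584, verbatim).  «Now we will construct an explicit representation for G_j. Let us introduce a Fourier
transform on ξZ^d by the formulas
  f̃(p) = Σ_x ξ^d e^{−ip·x} f(x),   f(x) = (2π)^{−d} ∫_{|p|≤π/ξ} e^{ix·p} f̃(p). (2.43)»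
(ξ = L^{−j}; the sum over x ∈ ξZ^d, the integral over the zone |p_μ| ≤ π/ξ.)

WHAT THIS MODULE PROVES (kernel-checked; 1 definition WITH BODY + theorems; 0 `sorry`; 0 `Prop` facts; axioms standard), in the
ξ-UNITS OF THE LINEAGE (`B4Green244`/`B4StripSums`/`B4ContourShift`): a fine point is `z ∈ ℤ^d` with `x = ξz`, `ξ = 1/n`
(`n = L^j`, any `n ≥ 1`), and a fine momentum `p` with `|p_μ| ≤ π/ξ` is written through the UNIT-ZONE variable `P = ξp ∈
[−π,π]^d = BZ d`, so that `e^{−ip·x} = e^{−iP·z}`; complex momenta `P : Fin d → ℂ` are allowed (the transform of a finitely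
supported function is entire), real ones enter as `ofRealVec`.
* `ft n S f P := Σ_{z∈S} ξ^d·e^{−iP·z}·f z` — THE FIRST FORMULA OF (2.43) WITH ITS BODY for a lattice function `f` whose support
  lies in the finite set `S` (the printed «Σ_x» is this finite sum for such `f`; `ξ^d = (n^d)⁻¹`);
* **`inversion243`** — THE SECOND FORMULA OF (2.43) AS A THEOREM: if `f` vanishes off `S` then for every `z`
  `f z = n^d · latticeKernel (ft n S f) z`, i.e. `f(x) = (2π)^{−d}∫_{|p|≤π/ξ} e^{ix·p} f̃(p) dp` after the substitution
  `p = P/ξ` (`dp = ξ^{−d}dP = n^d dP`; `latticeKernel G z = (2π)^{−d}∫_{[−π,π]^d} G(P) e^{iP·z} dP`, `B4ContourShift.latticeKernel`);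
  ingredients: finite superposition of zone-holomorphic multipliers (`B4Green244.latticeKernel_sum_mul`,
  `integrableOn_of_differentiableAt`), the pure-phase kernel `(2π)^{−d}∫e^{iP·(z−y)}dP = δ_{z,y}` (`B4Green244.latticeKernel_phase`),
  and the differentiability of `P ↦ e^{iP·s}` (private `differentiableAt_cexp_phaseC`);
* `ft_single` — the transform of a lattice delta `δ_y` is `ξ^d e^{−iP·y}` (so `f̃ = Q_j^*g`-type data are finite sums of phases).

DICTIONARY / HONEST SCOPE.  (i) Finitely supported `f` only (the support as a `Finset` datum `S`; print's Σ_x over all of ξZ^d is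
meant for the ℓ² functions it is applied to — the finitely supported case is the one the lineage's kernels use (deltas, `Q_j^*g` with
finitely supported `g`); the ℓ²/ℓ¹ extension is NOT typed here).  (ii) The zone `|p| ≤ π/ξ` is read coordinatewise (`|p_μ| ≤ π/ξ`, the
cube), as everywhere in the lineage (`BZ d = [−π,π]^d` after rescaling).  (iii) NOT in this file: the transformed equation (2.45) for a
general `φ₀` (member 3, the aliasing identity of `Q_j^*Q_j`) — row B4.Eq2.43 keeps `typed-existing` until it lands; (2.46) fibrewise is
member 2 (`B4Eq246Fibre`); (2.44) ⇐ (2.48) is `B4Green244.green244`.  Value = kernel certificate of one printed definition + its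
inversion formula; NOT summit progress.
-/

namespace Literature.MathematicalPhysics.QuantumFieldTheory.Balaban1983to89.B4Eq243Transform

open Complex Finset MeasureTheory
open Literature.MathematicalPhysics.QuantumFieldTheory.Balaban1983to89.B4Strip (ofRealVec)
open Literature.MathematicalPhysics.QuantumFieldTheory.Balaban1983to89.B4ContourShift (BZ latticeKernel integrand)
open Literature.MathematicalPhysics.QuantumFieldTheory.Balaban1983to89.B4Green244 (phaseC latticeKernel_phase
  latticeKernel_sum_mul integrableOn_of_differentiableAt)
open scoped Real

variable {d : ℕ}

/-- **THE FIRST FORMULA OF (2.43) WITH ITS BODY** (ξ-units, `ξ^d = (n^d)⁻¹`, unit-zone variable `P = ξp`):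
`f̃(P) = Σ_{z∈S} ξ^d e^{−iP·z} f(z)` for `f` supported in the finite set `S`. [cite: Balaban1983RegularityDecay, (2.43) p.584] -/
noncomputable def ft (n : ℕ) (S : Finset (Fin d → ℤ)) (f : (Fin d → ℤ) → ℂ) (P : Fin d → ℂ) : ℂ :=
  ∑ z ∈ S, (((n : ℂ) ^ d)⁻¹) * cexp (I * phaseC P (-z)) * f z

/-- unfolding of `ft`. [cite: Balaban1983RegularityDecay, (2.43) p.584] -/
theorem ft_apply (n : ℕ) (S : Finset (Fin d → ℤ)) (f : (Fin d → ℤ) → ℂ) (P : Fin d → ℂ) :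
    ft n S f P = ∑ z ∈ S, (((n : ℂ) ^ d)⁻¹) * cexp (I * phaseC P (-z)) * f z := rfl

/-- `e^{iP·(−z)} = e^{−iP·z}`: the sign convention of (2.43). [cite: Balaban1983RegularityDecay, (2.43) p.584, dictionary] -/
theorem phaseC_neg (P : Fin d → ℂ) (z : Fin d → ℤ) : phaseC P (-z) = -phaseC P z := by
  unfold phaseC
  rw [← Finset.sum_neg_distrib]
  apply Finset.sum_congr rfl
  intro μ _
  simp [mul_neg]

/-- the transform of a lattice delta `δ_y` (supported in any `S ∋ y`) is the pure phase `ξ^d e^{−iP·y}`.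
[cite: Balaban1983RegularityDecay, (2.43) p.584] -/
theorem ft_single (n : ℕ) {S : Finset (Fin d → ℤ)} {y : Fin d → ℤ} (hy : y ∈ S) (P : Fin d → ℂ) :
    ft n S (fun z => if z = y then 1 else 0) P = (((n : ℂ) ^ d)⁻¹) * cexp (I * phaseC P (-y)) := by
  rw [ft_apply, Finset.sum_eq_single y]
  · simp
  · intro z _ hz
    simp [hz]
  · intro h
    exact absurd hy h

/-- the pure phase `P ↦ e^{iP·s}` is complex-differentiable everywhere (so its zone integrand is integrable; private
plumbing for `inversion243`). [folklore] -/
private theorem differentiableAt_cexp_phaseC (s : Fin d → ℤ) (Q : Fin d → ℂ) :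
    DifferentiableAt ℂ (fun P : Fin d → ℂ => cexp (I * phaseC P s)) Q := by
  have hph : DifferentiableAt ℂ (fun P : Fin d → ℂ => phaseC P s) Q := by
    unfold phaseC
    apply DifferentiableAt.fun_sum
    intro μ _
    exact (differentiableAt_apply (𝕜 := ℂ) μ Q).mul_const _
  exact (hph.const_mul I).cexp

/-- **(2.43), SECOND FORMULA — FOURIER INVERSION FOR FINITELY SUPPORTED LATTICE FUNCTIONS**: if `f` vanishes off the finite
set `S`, then `f(z) = n^d · (2π)^{−d} ∫_{[−π,π]^d} e^{iP·z} f̃(P) dP` for every `z ∈ ℤ^d` — the printed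
`f(x) = (2π)^{−d}∫_{|p|≤π/ξ} e^{ix·p} f̃(p) dp` after `p = P/ξ`, `dp = n^d dP`. [cite: Balaban1983RegularityDecay, (2.43) p.584] -/
theorem inversion243 (n : ℕ) (S : Finset (Fin d → ℤ)) (f : (Fin d → ℤ) → ℂ) (hf : ∀ z ∉ S, f z = 0) (hn : n ≠ 0)
    (z : Fin d → ℤ) :
    f z = ((n : ℂ) ^ d) * latticeKernel (ft n S f) z := by
  -- the transform as a finite superposition of pure phases with coefficients `ξ^d f(y)`
  have hft : ft n S f = fun P => ∑ y ∈ S, ((((n : ℂ) ^ d)⁻¹) * f y) * cexp (I * phaseC P (-y)) := by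
    funext P
    rw [ft_apply]
    apply Finset.sum_congr rfl
    intro y _
    ring
  rw [hft, latticeKernel_sum_mul S (fun y => (((n : ℂ) ^ d)⁻¹) * f y) (fun y P => cexp (I * phaseC P (-y))) z
    (fun y _ => integrableOn_of_differentiableAt (fun p _ => differentiableAt_cexp_phaseC (-y) (ofRealVec p)) z)]
  simp_rw [latticeKernel_phase]
  -- `Σ_y ξ^d f(y) δ_{z − y, 0} = ξ^d f(z)` (or `0 = f z` off the support)
  have hδ : ∀ y ∈ S, (((n : ℂ) ^ d)⁻¹ * f y) * (if z + -y = 0 then (1 : ℂ) else 0)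
      = if y = z then ((n : ℂ) ^ d)⁻¹ * f z else 0 := by
    intro y _
    by_cases hyz : y = z
    · subst hyz; simp
    · have : z + -y ≠ 0 := by
        intro h; apply hyz
        have : z = y := by
          have := congrArg (· + y) h; simpa using this
        exact this.symm
      simp [this, hyz]
  rw [Finset.sum_congr rfl hδ, Finset.sum_ite_eq' S z]
  have hnd : ((n : ℂ) ^ d) ≠ 0 := pow_ne_zero _ (by exact_mod_cast hn)
  by_cases hz : z ∈ S
  · rw [if_pos hz, ← mul_assoc, mul_inv_cancel₀ hnd, one_mul]
  · rw [if_neg hz, mul_zero]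
    exact hf z hz

/-- (2.43) read back: the inversion integral, written as the printed average over the rescaled zone, recovers `f` on `S` and
gives `0` off `S` (consistency of the support datum). [cite: Balaban1983RegularityDecay, (2.43) p.584] -/
theorem latticeKernel_ft_eq (n : ℕ) (S : Finset (Fin d → ℤ)) (f : (Fin d → ℤ) → ℂ) (hf : ∀ z ∉ S, f z = 0) (hn : n ≠ 0)
    (z : Fin d → ℤ) :
    latticeKernel (ft n S f) z = (((n : ℂ) ^ d)⁻¹) * f z := by
  have hnd : ((n : ℂ) ^ d) ≠ 0 := pow_ne_zero _ (by exact_mod_cast hn)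
  have h := inversion243 n S f hf hn z
  rw [h, ← mul_assoc, inv_mul_cancel₀ hnd, one_mul]

/-- non-vacuity: a delta function on `ℤ¹` supported in `{0}` is recovered by the inversion formula at scale `n = 2`.
[cite: Balaban1983RegularityDecay, (2.43) p.584, dictionary] -/
example (z : Fin 1 → ℤ) :
    (if z = 0 then (1 : ℂ) else 0)
      = ((2 : ℕ) : ℂ) ^ 1 * latticeKernel (ft 2 {0} (fun w : Fin 1 → ℤ => if w = 0 then (1 : ℂ) else 0)) z :=
  inversion243 2 {0} (fun w : Fin 1 → ℤ => if w = 0 then (1 : ℂ) else 0)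
    (fun w hw => if_neg (by rwa [Finset.mem_singleton] at hw)) two_ne_zero z

end Literature.MathematicalPhysics.QuantumFieldTheory.Balaban1983to89.B4Eq243Transform
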